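import Summits.AnomalousDissipation.AnomalousDissipation.Theorems.SolenoidalFractalHomogenisationLagrangianStepFrameSecondGradient

/-!
# K1L_D (stmt-AnomalousDissipation-27980), `stub_Z7_alphaBetaR` α-part, K8-5 (ii): the SHARP CURVATURE of the inverse frame,
# `|∂_c (frameG)_{il}| ≤ Cs·N_m·(Σ_{i<m} a (i+1))·u ≤ Cs·N_m·strain m` on every CLOSED refresh piece (helper, `--supports 27980 --as helper`)

prover lead-k1l-onelevel-p1 g6 (K8-5; road of prover ad-k3l-bookkeeping-p1 g8).  This file discharges the ONE remaining hypothesis `hcurv`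
of `FrameForm.isModulation_frameG_closed` (p704979, prover ad-k1loc-p3 g9) — the input `hmod` of the α-part (α₁)(α₂) of `stub_Z7_alphaBetaR`
through `FrameConj.frameConjugacyAt_of_modulation` (p706082):
* §1 `partialDeriv_frameG_entry_eq` — on the closed piece `G·J = 1` (`det J = 1`), both factors smooth in the label, so the product rule
  gives `∂_e G = −G·(∂_e J)·G` entrywise;
* §2 `abs_partialDeriv_frameG_le_sharp` — `|G| ≤ 2` (`abs_frameG_sub_one_le_strain_closed` under the ceiling) and `|∂_e J_{ab}| = |∂_e∂_b D_a|
  ≤ C₂·N_m·S_m·u` (`abs_partialDeriv_partialDeriv_disp_le_closed`, K8-5 (i)) give `|∂_e G_{il}| ≤ 36·C₂·N_m·S_m·u`;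
* §3 **`abs_partialDeriv_frameG_le`** — the HCURV text of record VERBATIM (prover ad-k1loc-p3 g9, STATUS 2026-08-29T07:40:56Z; tenure
  07:41:15Z): `… ≤ Cs * E.N m * E.strain m` on `Icc 0 (t − jR)`, `jR < t ≤ (j+1)R` (from §2 by `S_m·u ≤ S_m·R = strain m`).
No sorry, no definition, no named fact.  NOT a proof of the stub, of K1L_D or of AD; rung F-D1.A0.
-/

set_option linter.dupNamespace false

noncomputable section

namespace Summit.AnomalousDissipation.AnomalousDissipation.Theorems.SolenoidalFractalHomogenisation.LagrangianStep.FrameForm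

open Set Function Filter MeasureTheory Topology
open scoped NNReal
open Literature.Analysis Literature.Analysis.ODE Literature.Analysis.FunctionSpaces
open Literature.Analysis.FunctionSpaces.Torus
open Literature.Analysis.FluidPDE Literature.Analysis.FluidPDE.LatticeShear
open Summit.AnomalousDissipation.AnomalousDissipation.Theorems.SolenoidalFractalHomogenisation.LagrangianCarrierConstruction
open Summit.AnomalousDissipation.AnomalousDissipation.Theorems.SolenoidalFractalHomogenisation.LagrangianCarrier

variable {k : ℕ}

/-! ## §1 The label derivative of the inverse frame: `∂_e G = −G·(∂_e J)·G` on the closed piece -/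

/-- **Derivative of the inverse frame.**  On the closed piece (`T ≤ refresh (m+1)`, `u ∈ [0,T]`) the inverse Jacobian `G = (∇X)⁻¹` of the
coarse flow satisfies, entrywise, `∂_e G_{il} = −(G · ∂_e J · G)_{il}` with `J = ∇X` (differentiate `G·J = 1`; `det J = 1` gives `J·G = 1`).
[cite: ArmstrongVicol2025, §5.1 (the inverse flow map); folklore matrix calculus] -/
theorem partialDeriv_frameG_entry_eq (E : LagrangianLatticeCarrier k) (hR : E.LevelRegular) {m : ℕ} (hF : E.IsFlow m) (j : ℤ)
    {T : ℝ} (hT : T ≤ E.refresh (m + 1)) {u : ℝ} (hu : u ∈ Icc 0 T) (y : UnitAddTorus (Fin 3)) (e i l : Fin 3) :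
    Torus.partialDeriv e (fun y' => frameG E m ((j : ℝ) * E.refresh (m + 1) + u) ((j : ℝ) * E.refresh (m + 1)) y' i l) y =
      -((frameG E m ((j : ℝ) * E.refresh (m + 1) + u) ((j : ℝ) * E.refresh (m + 1)) y *
          Matrix.of (fun a b => Torus.partialDeriv e
            (fun y' => frameJac E m ((j : ℝ) * E.refresh (m + 1) + u) ((j : ℝ) * E.refresh (m + 1)) y' a b) y) *
          frameG E m ((j : ℝ) * E.refresh (m + 1) + u) ((j : ℝ) * E.refresh (m + 1)) y) i l) := by
  set t : ℝ := (j : ℝ) * E.refresh (m + 1) + u with ht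
  set s : ℝ := (j : ℝ) * E.refresh (m + 1) with hs
  -- notation
  set G : UnitAddTorus (Fin 3) → Matrix (Fin 3) (Fin 3) ℝ := fun y' => frameG E m t s y' with hGdef
  set J : UnitAddTorus (Fin 3) → Matrix (Fin 3) (Fin 3) ℝ := fun y' => frameJac E m t s y' with hJdef
  set dG : Matrix (Fin 3) (Fin 3) ℝ := Matrix.of fun a b => Torus.partialDeriv e (fun y' => G y' a b) y with hdG
  set dJ : Matrix (Fin 3) (Fin 3) ℝ := Matrix.of fun a b => Torus.partialDeriv e (fun y' => J y' a b) y with hdJ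
  -- `G·J = 1 = J·G` pointwise (det J = 1 on the closed piece)
  have hdet : ∀ y', IsUnit (J y').det := fun y' => by
    rw [hJdef]; simp only; rw [ht, hs, FrameConj.det_frameJac_eq_one_closed E hR hF j hT hu y']; exact isUnit_one
  have hGJ : ∀ y', G y' * J y' = 1 := fun y' => by
    rw [hGdef, hJdef]; simp only [frameG]; exact Matrix.nonsing_inv_mul _ (hdet y')
  have hJG : J y * G y = 1 := by
    rw [hGdef, hJdef]; simp only [frameG]; exact Matrix.mul_nonsing_inv _ (hdet y)
  -- smoothness of the entries
  have hGs : ∀ a b, IsContDiff 1 (fun y' => G y' a b) := fun a b => by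
    rw [hGdef]; simp only; rw [ht, hs]
    exact (FrameConj.isSmooth_frameG_entry_closed E hR hF j hT hu a b).isContDiff (by simp)
  have hJs : ∀ a b, IsContDiff 1 (fun y' => J y' a b) := fun a b => by
    rw [hJdef]; simp only; rw [ht, hs]
    exact (isSmooth_frameJac_entry E hR j u a b).isContDiff (by simp)
  -- differentiate `Σ_a G_ia J_al = δ_il`
  have hprod : G y * dJ + dG * J y = 0 := by
    ext i' l'
    have hconst : Torus.partialDeriv e (fun y' => (G y' * J y') i' l') y = 0 := by
      have e1 : (fun y' => (G y' * J y') i' l') = fun _ => (1 : Matrix (Fin 3) (Fin 3) ℝ) i' l' := by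
        funext y'; rw [hGJ y']
      rw [e1]; simp [Torus.partialDeriv, Torus.lineDeriv]
    have hsum : Torus.partialDeriv e (fun y' => (G y' * J y') i' l') y =
        ∑ a, (G y i' a * Torus.partialDeriv e (fun y' => J y' a l') y + Torus.partialDeriv e (fun y' => G y' i' a) y * J y a l') := by
      have e2 : (fun y' => (G y' * J y') i' l') = fun y' => ∑ a, G y' i' a * J y' a l' := by
        funext y'; rw [Matrix.mul_apply]
      rw [e2, partialDeriv_finset_sum _ (fun a _ => ?_) e y]
      · exact Finset.sum_congr rfl fun a _ => partialDeriv_mul (hGs i' a) (hJs a l') e y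
      · exact (ContDiff.mul (hGs i' a) (hJs a l') : IsContDiff 1 fun y' => G y' i' a * J y' a l')
    rw [hconst] at hsum
    rw [Matrix.add_apply, Matrix.mul_apply, Matrix.mul_apply, Matrix.zero_apply, hsum, Finset.sum_add_distrib]
    simp only [hdG, hdJ, Matrix.of_apply]
  -- solve for `dG`
  have hsolve : dG = -(G y * dJ * G y) := by
    have h1 : dG * J y = -(G y * dJ) := eq_neg_of_add_eq_zero_right hprod
    calc dG = dG * (J y * G y) := by rw [hJG, Matrix.mul_one]
      _ = (dG * J y) * G y := by rw [Matrix.mul_assoc]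
      _ = -(G y * dJ * G y) := by rw [h1, Matrix.neg_mul]
  have h := congrFun (congrFun hsolve i) l
  rw [hdG, Matrix.of_apply] at h
  rw [h, Matrix.neg_apply]

/-! ## §2 The sharp curvature bound, linear in the elapsed time -/

/-- **K8-5, sharp form.**  For every design `W` there are `θs > 0` and `Cs ≥ 0` such that for every `LPermissible`, `Regular` carrier of
design `W` with `N_m² ≤ N_{m+1}` and the template (T4) at `θ₀ ≤ θs`, every level `m`, window index `j`, piece length `0 < T ≤ refresh (m+1)`,
`u ∈ [0, T]`, label `y` and indices: `|∂_c (frameG E m (jR+u) (jR))_{il} (y)| ≤ Cs · N_m · (Σ_{i<m} a (i+1)) · u`.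
[cite: ArmstrongVicol2025, §5.1 and App. A Prop. 7.10; Hartman2002, Ch. V Thm 3.1] -/
theorem abs_partialDeriv_frameG_le_sharp (k : ℕ) (W : LatticeWord k) : ∃ θs : ℝ, 0 < θs ∧ ∃ Cs : ℝ, 0 ≤ Cs ∧
    ∀ (E : LagrangianLatticeCarrier k) (θ₀ : ℝ), E.design = W → θ₀ ≤ θs → E.LPermissible → E.Regular →
      (∀ m, E.N m ^ 2 ≤ E.N (m + 1)) → (∀ m, E.θ (m + 1) * ((E.N (m + 1) : ℝ) / E.N m) ^ (1 / 16 : ℝ) ≤ θ₀) →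
      ∀ (m : ℕ) (j : ℤ) (T : ℝ), 0 < T → T ≤ E.refresh (m + 1) → ∀ u ∈ Icc 0 T, ∀ (y : UnitAddTorus (Fin 3)) (i l c : Fin 3),
        |Torus.partialDeriv c (fun y => frameG E m ((j : ℝ) * E.refresh (m + 1) + u) ((j : ℝ) * E.refresh (m + 1)) y i l) y| ≤
          Cs * E.N m * ((∑ i ∈ Finset.range m, E.a (i + 1)) * u) := by
  obtain ⟨θ₁, hθ₁, C, hC, H1⟩ := abs_frameG_sub_one_le_strain_closed k W
  obtain ⟨θ₂, hθ₂, C₂, hC₂, H2⟩ := abs_partialDeriv_partialDeriv_disp_le_closed k W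
  refine ⟨min (min θ₁ θ₂) (1 / (5 * C + 1)), lt_min (lt_min hθ₁ hθ₂) (by positivity), 36 * C₂, by positivity, ?_⟩
  intro E θ₀ hD hθs hLP hReg hsq hT4 m j T hT0 hT u hu y i l c
  have hθs₁ : θ₀ ≤ θ₁ := hθs.trans ((min_le_left _ _).trans (min_le_left _ _))
  have hθs₂ : θ₀ ≤ θ₂ := hθs.trans ((min_le_left _ _).trans (min_le_right _ _))
  have hθs₃ : θ₀ ≤ 1 / (5 * C + 1) := hθs.trans (min_le_right _ _)
  have hLR := hReg.levelRegular
  have hF : E.IsFlow m := (hLP.isLagrangian m).1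
  have hNpos : (0 : ℝ) < E.N m := by exact_mod_cast E.toFractalCarrierData.N_pos m
  set s : ℝ := (j : ℝ) * E.refresh (m + 1) with hs
  set S : ℝ := ∑ i ∈ Finset.range m, E.a (i + 1) with hSdef
  have hS0 : 0 ≤ S := Finset.sum_nonneg fun i _ => (E.toFractalCarrierData.a_pos _).le
  have hu0 : 0 ≤ u := hu.1
  -- `|G − 1| ≤ 5C·S·u ≤ 5C·θ₀ ≤ 1`, hence `|G| ≤ 2`
  have hstrain : S * u ≤ θ₀ :=
    calc S * u ≤ S * E.refresh (m + 1) := mul_le_mul_of_nonneg_left (hu.2.trans hT) hS0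
      _ = E.strain m := by rw [hSdef, LagrangianLatticeCarrier.strain]
      _ ≤ E.θ (m + 1) := hLP.strain_le m
      _ ≤ θ₀ := theta_le_of_template E hLP hT4 m
  have hG2 : ∀ a b : Fin 3, |frameG E m (s + u) s y a b| ≤ 2 := by
    intro a b
    have h := H1 E θ₀ hD hθs₁ hLP hReg hsq hT4 m j (s + u) (by rw [hs]; linarith) (by rw [hs]; linarith [hu.2.trans hT]) y a b
    have e1 : s + u - (j : ℝ) * E.refresh (m + 1) = u := by rw [hs]; ring
    rw [e1] at h
    have h5 : 5 * C * (S * u) ≤ 1 := by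
      have h6 : 5 * C * (S * u) ≤ 5 * C * θ₀ := mul_le_mul_of_nonneg_left hstrain (by positivity)
      have h7 : 5 * C * θ₀ ≤ 1 := by
        have h := mul_le_mul_of_nonneg_left hθs₃ (by positivity : (0:ℝ) ≤ 5 * C + 1)
        rw [mul_one_div_cancel (by positivity)] at h
        have hθ0 : 0 ≤ θ₀ := le_trans (mul_nonneg hS0 hu0) hstrain
        nlinarith
      linarith
    have hδ : |(1 : Matrix (Fin 3) (Fin 3) ℝ) a b| ≤ 1 := by rw [Matrix.one_apply]; split_ifs <;> simp
    calc |frameG E m (s + u) s y a b|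
        = |(frameG E m (s + u) s y a b - (1 : Matrix (Fin 3) (Fin 3) ℝ) a b) + (1 : Matrix (Fin 3) (Fin 3) ℝ) a b| := by rw [sub_add_cancel]
      _ ≤ |frameG E m (s + u) s y a b - (1 : Matrix (Fin 3) (Fin 3) ℝ) a b| + |(1 : Matrix (Fin 3) (Fin 3) ℝ) a b| := abs_add_le _ _
      _ ≤ 1 + 1 := add_le_add (h.trans h5) hδ
      _ = 2 := by norm_num
  -- `|∂_c J_{ab}| = |∂_c ∂_b D_a| ≤ C₂·N·S·u`
  have hdJ : ∀ a b : Fin 3, |Torus.partialDeriv c (fun y' => frameJac E m (s + u) s y' a b) y| ≤ C₂ * E.N m * (S * u) := by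
    intro a b
    have hd1 : IsContDiff 1 (Torus.partialDeriv b (fun z => E.disp m (s + u) s z a)) :=
      ((((hLR.isSmooth_disp m (s + u) s).apply a).partialDeriv b).isContDiff (by simp))
    have e1 : (fun y' => frameJac E m (s + u) s y' a b) =
        (fun _ => (1 : Matrix (Fin 3) (Fin 3) ℝ) a b) + Torus.partialDeriv b (fun z => E.disp m (s + u) s z a) := by
      funext y'; rw [Pi.add_apply, frameJac, Matrix.of_apply, hLR.flowDeriv_single_apply]
    have e2 : Torus.partialDeriv c (fun y' => frameJac E m (s + u) s y' a b) y =
        Torus.partialDeriv c (Torus.partialDeriv b (fun z => E.disp m (s + u) s z a)) y := by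
      rw [e1, partialDeriv_add (isContDiff_const _) hd1 c, Pi.add_apply]
      have h0 : Torus.partialDeriv c (fun _ : UnitAddTorus (Fin 3) => (1 : Matrix (Fin 3) (Fin 3) ℝ) a b) y = 0 := by
        simp [Torus.partialDeriv, Torus.lineDeriv]
      rw [h0, zero_add]
    rw [e2]
    exact H2 E θ₀ hD hθs₂ hLP hReg hsq hT4 m j T hT0 hT u hu c b a y
  -- assemble through §1
  rw [partialDeriv_frameG_entry_eq E hLR hF j hT hu y c i l, abs_neg, Matrix.mul_apply]
  have hM0 : 0 ≤ C₂ * E.N m * (S * u) := by positivity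
  calc |∑ b, (frameG E m (s + u) s y * Matrix.of fun a b => Torus.partialDeriv c (fun y' => frameJac E m (s + u) s y' a b) y) i b *
          frameG E m (s + u) s y b l|
      ≤ ∑ b, |(frameG E m (s + u) s y * Matrix.of fun a b => Torus.partialDeriv c (fun y' => frameJac E m (s + u) s y' a b) y) i b *
          frameG E m (s + u) s y b l| := Finset.abs_sum_le_sum_abs _ _
    _ ≤ ∑ _b : Fin 3, (3 * (2 * (C₂ * E.N m * (S * u)))) * 2 := Finset.sum_le_sum fun b _ => by
        rw [abs_mul]
        refine mul_le_mul ?_ (hG2 b l) (abs_nonneg _) (by positivity)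
        rw [Matrix.mul_apply]
        calc |∑ a, frameG E m (s + u) s y i a * (Matrix.of fun a b => Torus.partialDeriv c (fun y' => frameJac E m (s + u) s y' a b) y) a b|
            ≤ ∑ a, |frameG E m (s + u) s y i a * (Matrix.of fun a b => Torus.partialDeriv c (fun y' => frameJac E m (s + u) s y' a b) y) a b| :=
              Finset.abs_sum_le_sum_abs _ _
          _ ≤ ∑ _a : Fin 3, 2 * (C₂ * E.N m * (S * u)) := Finset.sum_le_sum fun a _ => by
              rw [abs_mul, Matrix.of_apply]
              exact mul_le_mul (hG2 i a) (hdJ a b) (abs_nonneg _) (by norm_num)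
          _ = 3 * (2 * (C₂ * E.N m * (S * u))) := by
              rw [Finset.sum_const, Finset.card_univ, Fintype.card_fin, nsmul_eq_mul]; push_cast; ring
    _ = 36 * C₂ * E.N m * (S * u) := by
        rw [Finset.sum_const, Finset.card_univ, Fintype.card_fin, nsmul_eq_mul]; push_cast; ring

/-! ## §3 HCURV — the K8-5 text of record, verbatim -/

/-- **K8-5 `hcurv` (HCURV text of record, prover ad-k1loc-p3 g9 2026-08-29T07:40:56Z, VERBATIM): the sharp curvature of the inverse frame on
the CLOSED refresh piece.**  For every `k` and design `W` there are `θs > 0` and `Cs ≥ 0` such that for every `LPermissible`, `Regular` carrier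
of design `W` with `N_m² ≤ N_{m+1}` and the template (T4) at `θ₀ ≤ θs`, every level `m`, window index `j`, piece end `jR < t ≤ (j+1)R`, every
`u ∈ [0, t − jR]`, label `y` and indices `i l c`: `|∂_c (frameG E m (jR+u) (jR))_{il} (y)| ≤ Cs · N_m · strain m` — the hypothesis `hcurv` of
`isModulation_frameG_closed` with `nC := (Cs/Cα)·N m` (resp. the input of `Z7_alphaBetaR_of_hcurv`).
[cite: ArmstrongVicol2025, §5.1 and App. A Prop. 7.10; Hartman2002, Ch. V Thm 3.1] -/
theorem abs_partialDeriv_frameG_le : ∀ k (W : LatticeWord k), ∃ θs > 0, ∃ Cs ≥ 0, ∀ (E : LagrangianLatticeCarrier k) (θ₀ : ℝ),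
    E.design = W → θ₀ ≤ θs → E.LPermissible → E.Regular → (∀ m, E.N m ^ 2 ≤ E.N (m + 1)) →
    (∀ m, E.θ (m + 1) * ((E.N (m + 1) : ℝ) / E.N m) ^ (1 / 16 : ℝ) ≤ θ₀) →
    ∀ (m : ℕ) (j : ℤ) (t : ℝ), (j : ℝ) * E.refresh (m + 1) < t → t ≤ ((j : ℝ) + 1) * E.refresh (m + 1) →
    ∀ u ∈ Set.Icc 0 (t - (j : ℝ) * E.refresh (m + 1)), ∀ (y : UnitAddTorus (Fin 3)) (i l c : Fin 3),
    |Torus.partialDeriv c (fun y => frameG E m ((j : ℝ) * E.refresh (m + 1) + u) ((j : ℝ) * E.refresh (m + 1)) y i l) y|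
      ≤ Cs * E.N m * E.strain m := by
  intro k W
  obtain ⟨θs, hθs, Cs, hCs, H⟩ := abs_partialDeriv_frameG_le_sharp k W
  refine ⟨θs, hθs, Cs, hCs, ?_⟩
  intro E θ₀ hD hθ hLP hReg hsq hT4 m j t hjt htR u hu y i l c
  have hT0 : 0 < t - (j : ℝ) * E.refresh (m + 1) := by linarith
  have hTR : t - (j : ℝ) * E.refresh (m + 1) ≤ E.refresh (m + 1) := by linarith
  have h := H E θ₀ hD hθ hLP hReg hsq hT4 m j (t - (j : ℝ) * E.refresh (m + 1)) hT0 hTR u hu y i l c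
  refine h.trans ?_
  have hS0 : 0 ≤ ∑ i ∈ Finset.range m, E.a (i + 1) := Finset.sum_nonneg fun i _ => (E.toFractalCarrierData.a_pos _).le
  have hNpos : (0 : ℝ) ≤ E.N m := by exact_mod_cast (E.toFractalCarrierData.N_pos m).le
  have hSu : (∑ i ∈ Finset.range m, E.a (i + 1)) * u ≤ E.strain m := by
    rw [LagrangianLatticeCarrier.strain]
    exact mul_le_mul_of_nonneg_left (hu.2.trans hTR) hS0
  exact mul_le_mul_of_nonneg_left hSu (mul_nonneg hCs hNpos)

end Summit.AnomalousDissipation.AnomalousDissipation.Theorems.SolenoidalFractalHomogenisation.LagrangianStep.FrameForm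

end
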